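import Summits.CriticalPhenomena.PercolationContinuityZ3.Theorems.Transplant.KNCellsStepsReachO
import Summits.CriticalPhenomena.PercolationContinuityZ3.Theorems.Transplant.KNCellsStepsReach
import Summits.CriticalPhenomena.PercolationContinuityZ3.Theorems.Transplant.KNCellsSchemeO
import Summits.CriticalPhenomena.PercolationContinuityZ3.Theorems.Transplant.KNCellsProcessO
import Summits.CriticalPhenomena.PercolationContinuityZ3.Theorems.Transplant.KNCellsStepsDefsO
import Summits.CriticalPhenomena.PercolationContinuityZ3.Theorems.Transplant.KNCellsStepsPin
import Literature.Probability.Percolation.OrientedHistorySiteRenormalizationRun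
import HarnessLib

/-!
# N2 (frames-only node `SamePDropOfSkeletonFrm₁`, OPEN) — ORIENTED MACRO LAYER (WAVE 0 (c1), (R-18) `q ≡ true`): the oriented twin of N1's `KNCellsStepsPin`

builds on p205010 (kernel theorem, internal audit signed; external expert review pending) — nothing in this file uses p205010; NOTHING is claimed about the
open node `SamePDropOfSkeletonFrm₁` (`SamePDropOfSkeletonNeg₁` is CLOSED in the tree and untouched by this file).
Status sentence (coordinator 2026-08-20T04:30Z): "θ(p_c) = 0 on ℤ^d, all d ≥ 2 — kernel-verified (Lean 4/Mathlib, standard axioms); internal adversarial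
audit SIGNED 2026-08-20 04:29Z; external expert review pending."
Lane `prim-bschramm-*`, seat `prim-bschramm-stmt` (gen 19); helper file (`--supports stmt-CriticalPhenomena-4575 --as helper`); N2-SCOPE §20, (R-18)/(R-19).
PORT RULES (HOME/prim-bschramm-stmt-g19/lean/port_orient.py): the history-site API is replaced by its ORIENTED twin at the fixed quadrant `qNE := fun _ => true`
(`HState.choice ↦ HState.ochoice qNE`, `mstOf ↦ omstOf qNE`, `mst/stN ↦ omst/ostN qNE`, `occFinal ↦ ooccFinal qNE`, `Lawful ↦ OLawful qNE`, onward directions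
`onward ↦ onwardO` = the POSITIVE ones, (N2-e)); every declaration whose text changes thereby — directly or through a changed declaration — is re-declared with the
suffix `O` (same namespace); unchanged declarations of the N1 file are NOT repeated (the N1 module is imported). Docstrings/citations are N1's.
N1 HEADER (kept for the reader):
* `Wpin h e a a' du P = pinW (Wfull h e a a' du) Bfr P` — the weighting under which (I1) asks for Lemma 12;
* `Wpin_apply_of_not_mem_wireSet` (supported on the pairs of `E_i ∪ E_{w,v} ∪ E_{v,x}`), `Wpin_apply_of_mem_F`/`_Bfr` (pinned values),
  **`Wpin_apply_of_fresh`** (graph weights on every other pair of the region — so every subbox of `E_{v,x}` avoiding `E_i ∪ E_{w,v}` sees plain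
  `p`-percolation), `Wpin_apply_of_not_adj` (non-edges are closed);
* **`ae_reachM`** — on a GOOD pattern, under `Wpin` the root is joined to `M_v` inside `E_i ∪ E_{w,v}` almost surely; hence
  **`one_le_real_reach_M`**: `P_{Wpin}(⋃ t ∈ M_v, root ↔ t) = 1` — the source hypothesis of Lemma 12 / `TargetProperty` with any `δ > 0`.
[cite: KozmaNitzan2024, §4 p. 30 (Step IV, first claim: Lemma 12 may be applied in Ω) — the ℤ^d model] [cite: GrimmettPercolation1999, §7.2]
-/
noncomputable section

open MeasureTheory ProbabilityTheory
open scoped ENNReal Classical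

namespace Summit.CriticalPhenomena.PercolationContinuityZ3.Theorems

namespace Transplant

namespace KNCells

open Literature.Probability.Percolation Literature.Probability.LatticeModels SimpleGraph GadgetSystem ProbeHistory HSiteScheme Contour

variable {V : Type*} [DecidableEq V] [Countable V]

namespace KSchA

variable {A : Type*} (G : SimpleGraph V) [G.LocallyFinite] (S : KSchA V A)

variable {G S}
variable {h : ProbeHistory V} {e : Site 2 × MDir} (hV : S.ValidO G h e) {a a' : A} {du : MDir} {P : Finset (Sym2 V)}
  {FD : FaceData V A} (hSt : StepsGeom S.Γ FD) (ha' : a' ∈ S.Γ.anchSet a (tgt e))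

omit [Countable V] in
/-- `Wpin` vanishes off the pairs of `E_i ∪ E_{w,v} ∪ E_{v,x}`. [folklore] -/
theorem Wpin_apply_of_not_mem_wireSetO (hP : P ⊆ S.Bfr G h e a) {x : Sym2 V} (hx : x ∉ wireSet (↑(S.Sx G h e a a' du) : Set V)) : ((S.Wpin G h e a a' du P x = 0) : Prop) := by
  have hxB : x ∉ (↑(S.Bfr G h e a) : Set (Sym2 V)) := by
    intro hxB
    apply hx
    have h1 := (Finset.mem_sdiff.1 (Finset.mem_coe.1 hxB)).1
    rw [baseF, mem_edgesIn_iff] at h1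
    induction x using Sym2.ind with
    | h y z =>
      exact mk_mem_wireSet_iff.2 ⟨Finset.mem_coe.2 (Finset.mem_union_left _ (h1.2 y (Sym2.mem_mk_left _ _))),
        Finset.mem_coe.2 (Finset.mem_union_left _ (h1.2 z (Sym2.mem_mk_right _ _))), ((SimpleGraph.mem_edgeSet G).1 h1.1).ne⟩
  have _ := hP
  unfold Wpin
  rw [pinW_apply_of_not_mem _ _ hxB]
  unfold Wfull
  exact restrW_apply_of_not_mem _ hx

omit [Countable V] in
include hSt ha' in
/-- **Off the explored and the freshly revealed edges, `Wpin` is the graph weighting** on the pairs of `E_i ∪ E_{w,v} ∪ E_{v,x}`. [folklore] -/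
theorem Wpin_apply_of_freshO {x : Sym2 V} (hx : x ∈ wireSet (↑(S.Sx G h e a a' du) : Set V)) (hxF : x ∉ S.F G h)
    (hxB : x ∉ S.Bfr G h e a) : ((S.Wpin G h e a a' du P x = KNLevels.lattW G S.p x) : Prop) := by
  have _ := hSt; have _ := ha'
  unfold Wpin Wfull
  rw [pinW_apply_of_not_mem _ _ (fun h' => hxB (Finset.mem_coe.1 h')), restrW_apply_of_mem _ hx,
    pinW_apply_of_not_mem _ _ (fun h' => hxF (Finset.mem_coe.1 h'))]

omit [Countable V] in
/-- A pair with an endpoint outside `E_i ∪ E_{w,v}` is neither explored nor freshly revealed, so `Wpin` gives it the graph weight (if inside the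
region). [folklore] -/
theorem Wpin_apply_of_not_mem_baseO (hF : S.F G h = edgesIn G (S.Vx G h)) {y z : V} (hy : y ∉ S.Vx G h ∪ S.Γ.Ewv a e.1 e.2)
    (hyz : s(y, z) ∈ wireSet (↑(S.Sx G h e a a' du) : Set V)) : ((S.Wpin G h e a a' du P s(y, z) = KNLevels.lattW G S.p s(y, z)) : Prop) := by
  have hxF : s(y, z) ∉ S.F G h := by
    rw [hF, mem_edgesIn_iff]
    exact fun h' => hy (Finset.mem_union_left _ (h'.2 y (Sym2.mem_mk_left _ _)))
  have hxB : s(y, z) ∉ S.Bfr G h e a := by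
    intro h'
    have h1 := (Finset.mem_sdiff.1 h').1
    rw [baseF, mem_edgesIn_iff] at h1
    exact hy (h1.2 y (Sym2.mem_mk_left _ _))
  unfold Wpin Wfull
  rw [pinW_apply_of_not_mem _ _ (fun h' => hxB (Finset.mem_coe.1 h')), restrW_apply_of_mem _ hyz,
    pinW_apply_of_not_mem _ _ (fun h' => hxF (Finset.mem_coe.1 h'))]

omit [Countable V] in
include hV in
/-- Non-edges of `G` are closed under `Wpin`. [folklore] -/
theorem Wpin_apply_of_not_mem_edgeSetO (hP : P ⊆ S.Bfr G h e a) {x : Sym2 V} (hx : x ∉ G.edgeSet) : ((S.Wpin G h e a a' du P x = 0) : Prop) := by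
  have hxF : x ∉ S.F G h := fun h' => hx (hV.mem_edgeSet_of_mem_F h')
  have hxB : x ∉ (↑(S.Bfr G h e a) : Set (Sym2 V)) := by
    intro h'
    have h1 := (Finset.mem_sdiff.1 (Finset.mem_coe.1 h')).1
    rw [baseF, mem_edgesIn_iff] at h1
    exact hx h1.1
  have _ := hP
  unfold Wpin Wfull
  rw [pinW_apply_of_not_mem _ _ hxB]
  by_cases hxS : x ∈ wireSet (↑(S.Sx G h e a a' du) : Set V)
  · rw [restrW_apply_of_mem _ hxS, pinW_apply_of_not_mem _ _ (fun h' => hxF (Finset.mem_coe.1 h')), KNLevels.lattW_apply, if_neg hx]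
  · exact restrW_apply_of_not_mem _ hxS

omit [Countable V] in
include hV hSt ha' in
/-- Under `Wpin` the recorded pattern holds on the explored edges, almost surely. [folklore] -/
theorem ae_cyl_FO : ((∀ᵐ ω ∂prodBernoulli (S.Wpin G h e a a' du P), ω ∈ localCylinder (↑(S.F G h) : Set (Sym2 V)) ↑(S.ξ G h)) : Prop) := by
  have hval : ∀ x ∈ (↑(S.F G h) : Set (Sym2 V)),
      S.Wpin G h e a a' du P x = if x ∈ (↑(S.ξ G h) : Set (Sym2 V)) then 1 else 0 := by
    intro x hx
    have hxB : x ∉ (↑(S.Bfr G h e a) : Set (Sym2 V)) := fun h' => (Finset.mem_sdiff.1 (Finset.mem_coe.1 h')).2 (Finset.mem_coe.1 hx)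
    have hxS : x ∈ wireSet (↑(S.Sx G h e a a' du) : Set V) := ValidO.coe_F_subset_wireSet hV ha' hSt hx
    unfold Wpin Wfull
    rw [pinW_apply_of_not_mem _ _ hxB, restrW_apply_of_mem _ hxS]
    by_cases hxξ : x ∈ (↑(S.ξ G h) : Set (Sym2 V))
    · rw [pinW_apply_of_mem_of_mem _ hx hxξ, if_pos hxξ]
    · rw [pinW_apply_of_mem_of_not_mem _ hx hxξ, if_neg hxξ]
  have : Countable (↑(S.F G h) : Set (Sym2 V)) := (S.F G h).finite_toSet.countable.to_subtype
  have hall : ∀ i : (↑(S.F G h) : Set (Sym2 V)), ∀ᵐ ω ∂prodBernoulli (S.Wpin G h e a a' du P),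
      ((i : Sym2 V) ∈ ω ↔ (i : Sym2 V) ∈ (↑(S.ξ G h) : Set (Sym2 V))) := by
    intro i
    by_cases hξ : (i : Sym2 V) ∈ (↑(S.ξ G h) : Set (Sym2 V))
    · filter_upwards [prodBernoulli_ae_mem_of_eq_one (S.Wpin G h e a a' du P) (i := i)
        (by rw [hval i i.2, if_pos hξ])] with ω hω using iff_of_true hω hξ
    · filter_upwards [prodBernoulli_ae_notMem (S.Wpin G h e a a' du P) (i := i)
        (by rw [hval i i.2, if_neg hξ])] with ω hω using iff_of_false hω hξ
  filter_upwards [ae_all_iff.2 hall] with ω hω i hi using hω ⟨i, hi⟩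

omit [Countable V] in
/-- Under `Wpin` the pattern `P` holds on the fresh edges of `E_i ∪ E_{w,v}`, almost surely. [folklore] -/
theorem ae_cyl_BfrO : ((∀ᵐ ω ∂prodBernoulli (S.Wpin G h e a a' du P), ω ∈ localCylinder (↑(S.Bfr G h e a) : Set (Sym2 V)) ↑P) : Prop) :=
  prodBernoulli_pinW_ae_localCylinder _ (S.Bfr G h e a).finite_toSet.countable _

include hV in
/-- Under `Wpin` no non-edge of `G` is open, almost surely. [folklore] -/
theorem ae_forall_notMem_WpinO (hP : P ⊆ S.Bfr G h e a) : ((∀ᵐ ω ∂prodBernoulli (S.Wpin G h e a a' du P),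
    ∀ x ∈ {x : Sym2 V | x ∉ G.edgeSet}, x ∉ ω) : Prop) :=
  prodBernoulli_ae_forall_notMem _ (Set.to_countable _) fun _ hx => Wpin_apply_of_not_mem_edgeSetO hV hP hx

include hV hSt ha' in
/-- **On a good pattern, under `Wpin` the root is joined to `M_v` inside `E_i ∪ E_{w,v}` almost surely**: almost every configuration agrees with
`ξ ∪ P` on every pair inside `E_i ∪ E_{w,v}`. [cite: KozmaNitzan2024, §4 p. 30 (Step IV)] -/
theorem ae_reachMO (hP : P ⊆ S.Bfr G h e a) (hgood : S.GoodPat G h e a P) : ((∀ᵐ ω ∂prodBernoulli (S.Wpin G h e a a' du P), ω ∈ S.ReachM G h e a) : Prop) := by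
  set D := S.Vx G h ∪ S.Γ.Ewv a e.1 e.2 with hD
  filter_upwards [ae_cyl_FO hV hSt ha' (P := P), ae_cyl_BfrO (S := S) (G := G) (h := h) (e := e) (a := a) (a' := a') (du := du) (P := P),
    ae_forall_notMem_WpinO hV hP (a' := a') (du := du)] with ω hω1 hωB hω2
  -- `ω` agrees with `ξ ∪ P` on every pair inside `D`
  have hag : ∀ x ∈ wireSet (↑D : Set V), x ∈ ω ↔ x ∈ ((↑(S.ξ G h) : Set (Sym2 V)) ∪ ↑P) := by
    intro x hxD
    by_cases hxE : x ∈ G.edgeSet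
    · have hxbase : x ∈ S.baseF G h e a := by
        rw [baseF, mem_edgesIn_iff]
        exact ⟨hxE, fun y hy => Finset.mem_coe.1 (hxD.1 y hy)⟩
      by_cases hxF : x ∈ S.F G h
      · have h1 := hω1 x (Finset.mem_coe.2 hxF)
        rw [Finset.mem_coe] at h1
        have hxP : x ∉ P := fun h' => (Finset.mem_sdiff.1 (hP h')).2 hxF
        constructor
        · intro hxω; exact Or.inl (Finset.mem_coe.2 (h1.1 hxω))
        · rintro (h2 | h2)
          · exact h1.2 (Finset.mem_coe.1 h2)
          · exact absurd (Finset.mem_coe.1 h2) hxP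
      · have hxB : x ∈ S.Bfr G h e a := Finset.mem_sdiff.2 ⟨hxbase, hxF⟩
        have h1 := hωB x (Finset.mem_coe.2 hxB)
        constructor
        · intro hxω; exact Or.inr (h1.1 hxω)
        · rintro (h2 | h2)
          · exact absurd (hV.ξ_sub (Finset.mem_coe.1 h2)) hxF
          · exact h1.2 h2
    · constructor
      · intro hxω; exact absurd hxω (hω2 x hxE)
      · rintro (h2 | h2)
        · exact absurd (hV.mem_edgeSet_of_mem_F (hV.ξ_sub (Finset.mem_coe.1 h2))) hxE
        · have := (Finset.mem_sdiff.1 (hP (Finset.mem_coe.1 h2))).1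
          rw [baseF, mem_edgesIn_iff] at this
          exact absurd this.1 hxE
  have hdet := determinedBy_biUnion_openConnIn (↑D : Set V) S.Γ.root (↑(S.Γ.M a (tgt e)) : Set V) subset_rfl
  rw [determinedBy_iff] at hdet
  have hgood' : ((↑(S.ξ G h) : Set (Sym2 V)) ∪ ↑P) ∈ S.ReachM G h e a := hgood
  unfold ReachM at hgood' ⊢
  refine (hdet _ ω ?_).1 hgood'
  ext x
  simp only [Set.mem_inter_iff]
  constructor
  · rintro ⟨hx, hxD⟩; exact ⟨(hag x hxD).2 hx, hxD⟩
  · rintro ⟨hxω, hxD⟩; exact ⟨(hag x hxD).1 hxω, hxD⟩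

include hV hSt ha' in
/-- **The source condition of Lemma 12 on a good pattern**: `P_{Wpin}(⋃ t ∈ M_v, root ↔ t) = 1` (so `> 1 - δ` for every `δ > 0`).
[cite: KozmaNitzan2024, §4 p. 30 (Step IV)] -/
theorem real_reach_M_eq_oneO (hP : P ⊆ S.Bfr G h e a) (hgood : S.GoodPat G h e a P) : (((prodBernoulli (S.Wpin G h e a a' du P)).real (⋃ t ∈ S.Γ.M a (tgt e), openConn S.Γ.root t) = 1) : Prop) := by
  refine le_antisymm measureReal_le_one ?_
  have h1 : (prodBernoulli (S.Wpin G h e a a' du P)).real (S.ReachM G h e a) = 1 := by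
    rw [← probReal_univ (μ := prodBernoulli (S.Wpin G h e a a' du P))]
    refine measureReal_congr ?_
    filter_upwards [ae_reachMO hV hSt ha' hP hgood] with ω hω
    exact propext ⟨fun _ => Set.mem_univ ω, fun _ => hω⟩
  rw [← h1]
  refine measureReal_mono ?_ (measure_ne_top _ _)
  rw [ReachM, ← Finset.set_biUnion_coe]
  exact biUnion_openConnIn_subset_biUnion_openConn _ _ _

include hV hSt ha' in
/-- The source condition in the `>`-form used by `KNLevels.TargetProperty` / Lemma 12. [folklore] -/
theorem lt_real_reach_MO (hP : P ⊆ S.Bfr G h e a) (hgood : S.GoodPat G h e a P) {δ : ℝ} (hδ : 0 < δ) : ((1 - δ < (prodBernoulli (S.Wpin G h e a a' du P)).real (⋃ t ∈ S.Γ.M a (tgt e), openConn S.Γ.root t)) : Prop) := by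
  rw [real_reach_M_eq_oneO hV hSt ha' hP hgood]; linarith

/-! ## The pattern's own path: the entry vertex is joined to the root almost surely -/

omit [Countable V] in
include hV in
/-- Under `Wpin` every edge of `ξ ∪ P` is open, almost surely. [folklore] -/
theorem ae_pattern_subsetO (hP : P ⊆ S.Bfr G h e a) : ((∀ᵐ ω ∂prodBernoulli (S.Wpin G h e a a' du P), ((↑(S.ξ G h) : Set (Sym2 V)) ∪ ↑P) ⊆ ω) : Prop) := by
  have hval : ∀ x ∈ ((↑(S.ξ G h) : Set (Sym2 V)) ∪ ↑P), S.Wpin G h e a a' du P x = 1 := by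
    rintro x (hx | hx)
    · have hxF : x ∈ (↑(S.F G h) : Set (Sym2 V)) := Finset.mem_coe.2 (hV.ξ_sub (Finset.mem_coe.1 hx))
      have hxB : x ∉ (↑(S.Bfr G h e a) : Set (Sym2 V)) := fun h' =>
        (Finset.mem_sdiff.1 (Finset.mem_coe.1 h')).2 (Finset.mem_coe.1 hxF)
      have hxE : x ∈ G.edgeSet := hV.mem_edgeSet_of_mem_F (Finset.mem_coe.1 hxF)
      have hxS : x ∈ wireSet (↑(S.Sx G h e a a' du) : Set V) := by
        have h1 := Finset.mem_coe.1 hxF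
        rw [hV.F_eq, mem_edgesIn_iff] at h1
        induction x using Sym2.ind with
        | h y z =>
          exact mk_mem_wireSet_iff.2 ⟨Finset.mem_coe.2 (Finset.mem_union_left _ (Finset.mem_union_left _ (h1.2 y (Sym2.mem_mk_left _ _)))),
            Finset.mem_coe.2 (Finset.mem_union_left _ (Finset.mem_union_left _ (h1.2 z (Sym2.mem_mk_right _ _)))),
            ((SimpleGraph.mem_edgeSet G).1 hxE).ne⟩
      unfold Wpin Wfull
      rw [pinW_apply_of_not_mem _ _ hxB, restrW_apply_of_mem _ hxS, pinW_apply_of_mem_of_mem _ hxF hx]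
    · unfold Wpin
      exact pinW_apply_of_mem_of_mem _ (Finset.mem_coe.2 (hP (Finset.mem_coe.1 hx))) hx
  have hcount : ((↑(S.ξ G h) : Set (Sym2 V)) ∪ ↑P).Countable := ((S.ξ G h).finite_toSet.union P.finite_toSet).countable
  have : Countable (((↑(S.ξ G h) : Set (Sym2 V)) ∪ ↑P : Set (Sym2 V))) := hcount.to_subtype
  have hall : ∀ i : (((↑(S.ξ G h) : Set (Sym2 V)) ∪ ↑P : Set (Sym2 V))), ∀ᵐ ω ∂prodBernoulli (S.Wpin G h e a a' du P), (i : Sym2 V) ∈ ω :=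
    fun i => prodBernoulli_ae_mem_of_eq_one _ (hval i i.2)
  filter_upwards [ae_all_iff.2 hall] with ω hω x hx using hω ⟨x, hx⟩

omit [Countable V] in
include hV in
/-- **The entry vertex is joined to the root almost surely**: every vertex reachable from the root in the graph of the edges `ξ ∪ P` (a path
inside `E_i ∪ E_{w,v}`, these being edges of that region) is, under `Wpin`, almost surely joined to the root by an open path inside
`E_i ∪ E_{w,v}` — in particular the vertex of `M_v` defining the departure anchor `patAnchor P`. [cite: KozmaNitzan2024, §4 p. 30 (Step IV)] -/
theorem ae_openConnIn_of_reachableO (hP : P ⊆ S.Bfr G h e a) {y : V}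
    (hy : (SimpleGraph.fromEdgeSet ((↑(S.ξ G h) : Set (Sym2 V)) ∪ ↑P)).Reachable S.Γ.root y) : ((∀ᵐ ω ∂prodBernoulli (S.Wpin G h e a a' du P), ω ∈ openConnIn (↑(S.Vx G h ∪ S.Γ.Ewv a e.1 e.2) : Set V) S.Γ.root y) : Prop) := by
  set D := S.Vx G h ∪ S.Γ.Ewv a e.1 e.2 with hD
  -- every edge of `ξ ∪ P` is an edge of `G` inside `D`
  have hin : ∀ x ∈ ((↑(S.ξ G h) : Set (Sym2 V)) ∪ ↑P), x ∈ G.edgeSet ∧ ∀ z ∈ x, z ∈ D := by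
    rintro x (hx | hx)
    · have h1 := hV.ξ_sub (Finset.mem_coe.1 hx)
      rw [hV.F_eq, mem_edgesIn_iff] at h1
      exact ⟨h1.1, fun z hz => Finset.mem_union_left _ (h1.2 z hz)⟩
    · have h1 := (Finset.mem_sdiff.1 (hP (Finset.mem_coe.1 hx))).1
      rw [baseF, mem_edgesIn_iff] at h1
      exact ⟨h1.1, h1.2⟩
  filter_upwards [ae_pattern_subsetO hV hP (a' := a') (du := du)] with ω hω
  refine DCT16.mem_openConnIn_iff_pathIn.2 ?_
  rw [SimpleGraph.reachable_iff_reflTransGen] at hy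
  have h0 : S.Γ.root ∈ (↑D : Set V) := Finset.mem_coe.2 (Finset.mem_union_left _ hV.root_mem)
  refine ⟨h0, ?_⟩
  induction hy with
  | refl => exact Relation.ReflTransGen.refl
  | @tail b c _ hbc ih =>
    rw [SimpleGraph.fromEdgeSet_adj] at hbc
    obtain ⟨hmem, hne⟩ := hbc
    obtain ⟨-, hD'⟩ := hin _ hmem
    refine ih.tail ⟨?_, Finset.mem_coe.2 (hD' c (Sym2.mem_mk_right _ _))⟩
    rw [openGraph_adj]
    exact ⟨hω hmem, hne⟩

end KSchA

end KNCells

end Transplant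

end Summit.CriticalPhenomena.PercolationContinuityZ3.Theorems

end
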